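import Summits.HubbardSuperconductivity.HubbardSuperconductivity.Theorems.LevyLogBootstrapBlock2InfDivXXZLevyEquivalence
import Summits.HubbardSuperconductivity.HubbardSuperconductivity.Theorems.LevyLogBootstrapLevyTransportKernelPositivity
import Summits.HubbardSuperconductivity.HubbardSuperconductivity.Theorems.LevyLogBootstrapLevyTransportBlockSums
import Literature.Probability.LatticeModels.TorusLevyKhintchine
import HarnessLib

/-!
# Crux `LevyTransport` (stmt-HubbardSuperconductivity-15049, route `LevyLogBootstrap`):
# the Lévy bootstrap lemma along half-filled ground states (layer P1 of `stub_logBootstrap`)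

The birth skeleton `Cruxes/LevyTransport/Lines/birth.lean` foresees its load-bearing stub
`stub_logBootstrap` split as `P1`–`P5`, with `P1` "the deterministic LÉVY BOOTSTRAP LEMMA for an
infinitely divisible positive kernel on `(ℤ/n)²` … provable now, the new mechanism's engine, fed by
`Block2InfDivXXZ`". This file proves `P1` ALONG THE GROUND STATES, in the skeleton's own terms:

* `levyMass_fine_eq_coarse` — the skeleton's Lévy mass `levyMass M ψ = M⁻² Σ_x -log(K₂(x,0)/K₂(0,0))`
  (fine torus, unfolded) equals the coarse mean `n⁻² Σ_X (log k₂(0) - log k₂(X))`, `n = M/2`, of the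
  coarse block kernel `k₂(X) = Σ_{β x' = X, β y' = 0} Re⟨ψ, S⁺_{x'}S⁻_{y'}ψ⟩` of
  `Theorems/…LevyReduction.lean` (each 2×2 block has four sites, `LevyFloor.card_filter_block`);
* `coarseKernel_pos` — `k₂ > 0` along sector ground states (Perron–Frobenius,
  `LevyFloor.transverseKernel_pos_all`);
* `stub_levyBootstrapShape` (registered sub-goal of stmt-…-15049) — for every even `M ≥ 4`, real `Δ`,
  normalised `S^z_tot = 0` sector ground state `ψ` whose coarse block kernel has nonnegative Lévy
  coefficients (`ν_q ≥ 0`, `q ≠ 0` — by `levyCoeff_nonneg_of_Block2InfDivXXZ` exactly what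
  `Block2InfDivXXZ` supplies on `Δ ∈ [-1,0]`), every set `S` of nonzero coarse momenta, displacements
  `D` and `c > 0` with `Σ_{Z∈D}(1 - Re χ_q(Z)) ≥ c` on `S`:
  `levyMass ≤ U + β·exp(levyMass)` with `U = (Σ_{Z∈D} (log k₂(0) - log k₂(Z)))/c` (LOCAL block
  log-decoherence) and `β = (Σ_{q∉S, q≠0} k̂₂(q)) / (n² k₂(0))` (INFRARED wing of the block structure
  factor) — `Literature.Probability.LatticeModels.levyMass_le_logBootstrap` instantiated;
* `levyBootstrapShape_of_Block2InfDivXXZ` — the same with the Lévy hypothesis discharged from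
  `Block2InfDivXXZ` on `Δ ∈ [-1,0]` (the antecedent of `stub_logBootstrap`).

What remains of `stub_logBootstrap` after this file are its PHYSICAL inputs: M-uniform bounds on `U`
(local coherence, (b)) and `β` (infrared bound, (a)), the pointwise KLS anchor (c) and the numerical
compatibility (d) — the constants `U_κ, β_κ` of the route.

Sources: Berg–Christensen–Ressel (1984) Ch. 3 §1–2, Ch. 4 §3; G. Slade, LNM 1879 (2006) Lemma 5.9
(bootstrap shape); card `levy-mass-log-bootstrap`. No definition is introduced; sorry-free.
-/

noncomputable section

set_option linter.dupNamespace false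

namespace Summit.HubbardSuperconductivity.HubbardSuperconductivity.Theorems.LevyLogBootstrap

open scoped BigOperators Matrix ComplexOrder ComplexConjugate
open Matrix Finset Complex
open Literature.MathematicalPhysics.QuantumLattice Literature.Probability.LatticeModels

section Coarse

variable (M : ℕ) {m : ℕ} [NeZero M] [NeZero m]

/-- **The coarse block kernel is entrywise positive along sector ground states** (every even
`M ≥ 4`, every real `Δ`): the block sum `k₂(X)` over `β x' = X`, `β y' = 0` consists of strictly
positive raw correlations `Re⟨ψ, S⁺_{x'}S⁻_{y'}ψ⟩ > 0` (Perron–Frobenius,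
`LevyFloor.transverseKernel_pos_all`) and is nonempty (`x' = 2X`, `y' = 0`). [folklore] -/
theorem coarseKernel_pos (hM : M = 2 * m) (hEven : Even M) (h4 : 4 ≤ M) (Δ : ℝ)
    (ψ : TensorIndex (TorusSite 2 M) 2 → ℂ)
    (hψ : ψ ∈ @spinZSector (TorusSite 2 M) _ _ 1 0) (hnorm : star ψ ⬝ᵥ ψ = 1)
    (heig : Matrix.mulVec (xxzHamiltonian 1 (torusGraph 2 M) (-1) Δ) ψ =
      ((lowestEnergyInSector 1 (xxzHamiltonian 1 (torusGraph 2 M) (-1) Δ) 0 : ℝ) : ℂ) • ψ)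
    (X : TorusSite 2 m) :
    0 < ∑ x' : TorusSite 2 M, ∑ y' : TorusSite 2 M,
      (if (∀ i : Fin 2, (x' i).val / 2 = (X i).val) ∧ (∀ i : Fin 2, (y' i).val / 2 = 0) then
        (star ψ ⬝ᵥ Matrix.mulVec (onSite x' (spinRaise 1) * onSite y' (spinLower 1)) ψ).re
      else 0) := by
  have hK : ∀ x' y' : TorusSite 2 M, 0 < (star ψ ⬝ᵥ Matrix.mulVec
      (onSite x' (spinRaise 1) * onSite y' (spinLower 1)) ψ).re :=
    LevyFloor.transverseKernel_pos_all M hEven h4 Δ ψ hψ hnorm heig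
  have hnn : ∀ x' y' : TorusSite 2 M, 0 ≤
      (if (∀ i : Fin 2, (x' i).val / 2 = (X i).val) ∧ (∀ i : Fin 2, (y' i).val / 2 = 0) then
        (star ψ ⬝ᵥ Matrix.mulVec (onSite x' (spinRaise 1) * onSite y' (spinLower 1)) ψ).re
      else 0) := fun x' y' => by
    split_ifs
    · exact (hK x' y').le
    · exact le_rfl
  -- the witness: the even fine site `2X` in block `X` and the origin in block `0`
  set w : TorusSite 2 M := fun j => ((2 * (X j).val : ℕ) : ZMod M) with hw
  have hwval : ∀ i : Fin 2, (w i).val / 2 = (X i).val := fun i => by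
    have hlt : 2 * (X i).val < M := by
      have := ZMod.val_lt (X i)
      omega
    simp only [hw, ZMod.val_natCast_of_lt hlt]
    omega
  have h0val : ∀ i : Fin 2, ((0 : TorusSite 2 M) i).val / 2 = 0 := fun i => by
    simp only [Pi.zero_apply, ZMod.val_zero, Nat.zero_div]
  refine Finset.sum_pos' (fun x' _ => Finset.sum_nonneg fun y' _ => hnn x' y') ⟨w, mem_univ _, ?_⟩
  refine Finset.sum_pos' (fun y' _ => hnn w y') ⟨0, mem_univ _, ?_⟩
  rw [if_pos ⟨hwval, h0val⟩]
  exact hK w 0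

/-- **The fine Lévy mass is the coarse mean.** For even `M = 2m` and a normalised `S^z_tot = 0`
sector ground state `ψ`, the skeleton's Lévy mass (fine torus, each block counted four times and
divided by `M² = 4m²`) equals `m⁻² Σ_X (log k₂(0) - log k₂(X))` for the coarse block kernel `k₂`:
`K₂(x, 0) = k₂(β x)` (`block2Kernel_eq_coarse`), every fibre of `β` has four sites
(`LevyFloor.card_filter_block`), and `-log(a/b) = log b - log a` for positive entries. [folklore] -/
theorem levyMass_fine_eq_coarse (hM : M = 2 * m) (hEven : Even M) (h4 : 4 ≤ M) (Δ : ℝ)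
    (ψ : TensorIndex (TorusSite 2 M) 2 → ℂ)
    (hψ : ψ ∈ @spinZSector (TorusSite 2 M) _ _ 1 0) (hnorm : star ψ ⬝ᵥ ψ = 1)
    (heig : Matrix.mulVec (xxzHamiltonian 1 (torusGraph 2 M) (-1) Δ) ψ =
      ((lowestEnergyInSector 1 (xxzHamiltonian 1 (torusGraph 2 M) (-1) Δ) 0 : ℝ) : ℂ) • ψ) :
    (∑ x : TorusSite 2 M, -Real.log ((∑ x' : TorusSite 2 M, ∑ y' : TorusSite 2 M,
        if (∀ i : Fin 2, (x' i).val / 2 = (x i).val / 2) ∧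
          (∀ i : Fin 2, (y' i).val / 2 = ((0 : TorusSite 2 M) i).val / 2)
        then (star ψ ⬝ᵥ Matrix.mulVec (onSite x' (spinRaise 1) * onSite y' (spinLower 1)) ψ).re
        else 0) /
      (∑ x' : TorusSite 2 M, ∑ y' : TorusSite 2 M,
        if (∀ i : Fin 2, (x' i).val / 2 = ((0 : TorusSite 2 M) i).val / 2) ∧
          (∀ i : Fin 2, (y' i).val / 2 = ((0 : TorusSite 2 M) i).val / 2)
        then (star ψ ⬝ᵥ Matrix.mulVec (onSite x' (spinRaise 1) * onSite y' (spinLower 1)) ψ).re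
        else 0))) / (M : ℝ) ^ 2 =
    (∑ X : TorusSite 2 m, (Real.log (∑ x' : TorusSite 2 M, ∑ y' : TorusSite 2 M,
        if (∀ i : Fin 2, (x' i).val / 2 = ((0 : TorusSite 2 m) i).val) ∧
          (∀ i : Fin 2, (y' i).val / 2 = 0)
        then (star ψ ⬝ᵥ Matrix.mulVec (onSite x' (spinRaise 1) * onSite y' (spinLower 1)) ψ).re
        else 0) -
      Real.log (∑ x' : TorusSite 2 M, ∑ y' : TorusSite 2 M,
        if (∀ i : Fin 2, (x' i).val / 2 = (X i).val) ∧ (∀ i : Fin 2, (y' i).val / 2 = 0)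
        then (star ψ ⬝ᵥ Matrix.mulVec (onSite x' (spinRaise 1) * onSite y' (spinLower 1)) ψ).re
        else 0))) / ((m : ℕ) : ℝ) ^ 2 := by
  classical
  -- the coarse kernel and the coarse coordinate
  set k₂ : TorusSite 2 m → ℝ := fun X => ∑ x' : TorusSite 2 M, ∑ y' : TorusSite 2 M,
      if (∀ i : Fin 2, (x' i).val / 2 = (X i).val) ∧ (∀ i : Fin 2, (y' i).val / 2 = 0) then
        (star ψ ⬝ᵥ Matrix.mulVec (onSite x' (spinRaise 1) * onSite y' (spinLower 1)) ψ).re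
      else 0 with hk₂
  set β : TorusSite 2 M → TorusSite 2 m := fun x i => (((x i).val / 2 : ℕ) : ZMod m) with hβ
  have hβ0 : β 0 = 0 := by
    funext i
    simp [hβ]
  -- `K₂(x, 0) = k₂(β x)`
  have hfac : ∀ x : TorusSite 2 M, (∑ x' : TorusSite 2 M, ∑ y' : TorusSite 2 M,
      if (∀ i : Fin 2, (x' i).val / 2 = (x i).val / 2) ∧
          (∀ i : Fin 2, (y' i).val / 2 = ((0 : TorusSite 2 M) i).val / 2)
      then (star ψ ⬝ᵥ Matrix.mulVec (onSite x' (spinRaise 1) * onSite y' (spinLower 1)) ψ).re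
      else 0) = k₂ (β x) := fun x => by
    have h := block2Kernel_eq_coarse M hM hEven Δ ψ hψ hnorm heig x 0
    rw [h]
    simp only [hk₂]
    refine Finset.sum_congr rfl fun x' _ => Finset.sum_congr rfl fun y' _ => ?_
    have hco : ((fun i : Fin 2 => (((x i).val / 2 : ℕ) : ZMod m)) -
        fun i : Fin 2 => ((((0 : TorusSite 2 M) i).val / 2 : ℕ) : ZMod m)) = β x := by
      have : (fun i : Fin 2 => ((((0 : TorusSite 2 M) i).val / 2 : ℕ) : ZMod m)) = β 0 := rfl
      rw [this, hβ0, sub_zero]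
    rw [hco]
  have hpos : ∀ X, 0 < k₂ X := fun X => coarseKernel_pos M hM hEven h4 Δ ψ hψ hnorm heig X
  -- rewrite the fine sum through `β`
  have hfine : ∑ x : TorusSite 2 M, -Real.log ((∑ x' : TorusSite 2 M, ∑ y' : TorusSite 2 M,
        if (∀ i : Fin 2, (x' i).val / 2 = (x i).val / 2) ∧
          (∀ i : Fin 2, (y' i).val / 2 = ((0 : TorusSite 2 M) i).val / 2)
        then (star ψ ⬝ᵥ Matrix.mulVec (onSite x' (spinRaise 1) * onSite y' (spinLower 1)) ψ).re
        else 0) /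
      (∑ x' : TorusSite 2 M, ∑ y' : TorusSite 2 M,
        if (∀ i : Fin 2, (x' i).val / 2 = ((0 : TorusSite 2 M) i).val / 2) ∧
          (∀ i : Fin 2, (y' i).val / 2 = ((0 : TorusSite 2 M) i).val / 2)
        then (star ψ ⬝ᵥ Matrix.mulVec (onSite x' (spinRaise 1) * onSite y' (spinLower 1)) ψ).re
        else 0)) =
      ∑ x : TorusSite 2 M, (Real.log (k₂ 0) - Real.log (k₂ (β x))) := by
    refine Finset.sum_congr rfl fun x _ => ?_
    rw [hfac x, hfac 0, hβ0, Real.log_div (hpos _).ne' (hpos 0).ne', neg_sub]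
  -- sum over the fibres of `β`: each has four sites
  have hfib : ∑ x : TorusSite 2 M, (Real.log (k₂ 0) - Real.log (k₂ (β x))) =
      4 * ∑ X : TorusSite 2 m, (Real.log (k₂ 0) - Real.log (k₂ X)) := by
    rw [← Finset.sum_fiberwise_of_maps_to (s := univ) (t := univ) (g := β) (fun x _ => mem_univ _),
      Finset.mul_sum]
    refine Finset.sum_congr rfl fun X _ => ?_
    have hconst : ∑ x ∈ univ.filter (fun x => β x = X), (Real.log (k₂ 0) - Real.log (k₂ (β x))) =
        ∑ x ∈ univ.filter (fun x => β x = X), (Real.log (k₂ 0) - Real.log (k₂ X)) :=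
      Finset.sum_congr rfl fun x hx => by rw [(Finset.mem_filter.1 hx).2]
    rw [hconst, Finset.sum_const, nsmul_eq_mul]
    have hflt : univ.filter (fun x : TorusSite 2 M => β x = X) =
        univ.filter (fun x : TorusSite 2 M => ∀ i : Fin 2, (x i).val / 2 = (X i).val) := by
      refine Finset.filter_congr fun x _ => ?_
      rw [hβ]
      exact (block_iff_coarse_eq' (M := M) (m := m) hM x X).symm
    have hXlt : ∀ i : Fin 2, (X i).val < M / 2 := fun i => by
      have := ZMod.val_lt (X i)
      omega
    rw [hflt, LevyFloor.card_filter_block M hEven (fun i => (X i).val) hXlt]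
    norm_num
  have hk0 : k₂ 0 = ∑ x' : TorusSite 2 M, ∑ y' : TorusSite 2 M,
      if (∀ i : Fin 2, (x' i).val / 2 = ((0 : TorusSite 2 m) i).val) ∧
          (∀ i : Fin 2, (y' i).val / 2 = 0)
      then (star ψ ⬝ᵥ Matrix.mulVec (onSite x' (spinRaise 1) * onSite y' (spinLower 1)) ψ).re
      else 0 := rfl
  rw [hfine, hfib, ← hk0]
  have hMm : (M : ℝ) ^ 2 = 4 * ((m : ℕ) : ℝ) ^ 2 := by
    rw [hM]
    push_cast
    ring
  have hm0 : ((m : ℕ) : ℝ) ≠ 0 := Nat.cast_ne_zero.2 (NeZero.ne m)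
  rw [hMm]
  field_simp
  simp only [hk₂]

end Coarse

/-! ### The Lévy bootstrap lemma along half-filled ground states -/

/-- **`stub_levyBootstrapShape` — THE LÉVY BOOTSTRAP LEMMA ALONG HALF-FILLED GROUND STATES**
(layer `P1` of `stub_logBootstrap`, crux `LevyTransport`, stmt-HubbardSuperconductivity-15049).
For every even `M ≥ 4`, every real `Δ`, every normalised `S^z_tot = 0` sector ground state `ψ` of
`H_M(Δ) = xxzHamiltonian 1 (torusGraph 2 M) (-1) Δ` whose coarse 2×2-block kernel `k₂` has
nonnegative Lévy coefficients (`0 ≤ Σ_X log k₂(X) Re χ_q(X)` for all coarse `q ≠ 0` — infinite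
divisibility, supplied by `Block2InfDivXXZ` via `levyCoeff_nonneg_of_Block2InfDivXXZ`), and every
choice of a set `S` of nonzero coarse momenta ("ultraviolet"), displacements `D` and `c > 0` with
`Σ_{Z∈D} (1 - Re χ_q(Z)) ≥ c` on `S`, the skeleton's Lévy mass `|ν| = levyMass M ψ` (written out)
obeys the LOG-BOOTSTRAP INEQUALITY
`|ν| ≤ (Σ_{Z∈D} (log k₂(0) - log k₂(Z)))/c + (Σ_{q∉S, q≠0} Σ_X k₂(X) Re χ_q(X))/(n² k₂(0)) · e^{|ν|}`,
`n = M/2` — i.e. `|ν| ≤ U + β e^{|ν|}` with the local log-decoherence `U` and the infrared wing `β`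
of the route. (`Literature.Probability.LatticeModels.levyMass_le_logBootstrap` on the coarse torus,
`levyMass_fine_eq_coarse`, `coarseKernel_pos`, `coarseKernel_neg`.) Berg–Christensen–Ressel (1984)
Ch. 3–4; Slade (2006) Lemma 5.9; card `levy-mass-log-bootstrap`. [folklore] -/
theorem stub_levyBootstrapShape :
    ∀ (M : ℕ) [NeZero M] [NeZero (M / 2)], Even M → 4 ≤ M → ∀ (Δ : ℝ)
      (ψ : TensorIndex (TorusSite 2 M) 2 → ℂ),
      ψ ∈ @spinZSector (TorusSite 2 M) _ _ 1 0 → star ψ ⬝ᵥ ψ = 1 →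
      Matrix.mulVec (xxzHamiltonian 1 (torusGraph 2 M) (-1) Δ) ψ =
        ((lowestEnergyInSector 1 (xxzHamiltonian 1 (torusGraph 2 M) (-1) Δ) 0 : ℝ) : ℂ) • ψ →
      (∀ q : TorusSite 2 (M / 2), q ≠ 0 →
        0 ≤ ∑ X : TorusSite 2 (M / 2), Real.log (∑ x' : TorusSite 2 M, ∑ y' : TorusSite 2 M,
              if (∀ i : Fin 2, (x' i).val / 2 = (X i).val) ∧ (∀ i : Fin 2, (y' i).val / 2 = 0) then
                (star ψ ⬝ᵥ Matrix.mulVec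
                  (onSite x' (spinRaise 1) * onSite y' (spinLower 1)) ψ).re
              else 0) * (torusChar q X).re) →
      ∀ (S D : Finset (TorusSite 2 (M / 2))) (c : ℝ), (∀ q ∈ S, q ≠ 0) → 0 < c →
        (∀ q ∈ S, c ≤ ∑ Z ∈ D, (1 - (torusChar q Z).re)) →
        (∑ x : TorusSite 2 M, -Real.log ((∑ x' : TorusSite 2 M, ∑ y' : TorusSite 2 M,
            if (∀ i : Fin 2, (x' i).val / 2 = (x i).val / 2) ∧
              (∀ i : Fin 2, (y' i).val / 2 = ((0 : TorusSite 2 M) i).val / 2)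
            then (star ψ ⬝ᵥ Matrix.mulVec (onSite x' (spinRaise 1) * onSite y' (spinLower 1)) ψ).re
            else 0) /
          (∑ x' : TorusSite 2 M, ∑ y' : TorusSite 2 M,
            if (∀ i : Fin 2, (x' i).val / 2 = ((0 : TorusSite 2 M) i).val / 2) ∧
              (∀ i : Fin 2, (y' i).val / 2 = ((0 : TorusSite 2 M) i).val / 2)
            then (star ψ ⬝ᵥ Matrix.mulVec (onSite x' (spinRaise 1) * onSite y' (spinLower 1)) ψ).re
            else 0))) / (M : ℝ) ^ 2 ≤
        (∑ Z ∈ D, (Real.log (∑ x' : TorusSite 2 M, ∑ y' : TorusSite 2 M,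
              if (∀ i : Fin 2, (x' i).val / 2 = ((0 : TorusSite 2 (M / 2)) i).val) ∧
                (∀ i : Fin 2, (y' i).val / 2 = 0) then
                (star ψ ⬝ᵥ Matrix.mulVec
                  (onSite x' (spinRaise 1) * onSite y' (spinLower 1)) ψ).re
              else 0) -
            Real.log (∑ x' : TorusSite 2 M, ∑ y' : TorusSite 2 M,
              if (∀ i : Fin 2, (x' i).val / 2 = (Z i).val) ∧ (∀ i : Fin 2, (y' i).val / 2 = 0) then
                (star ψ ⬝ᵥ Matrix.mulVec
                  (onSite x' (spinRaise 1) * onSite y' (spinLower 1)) ψ).re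
              else 0))) / c +
        (∑ q ∈ (Finset.univ.erase 0) \ S, ∑ X : TorusSite 2 (M / 2),
            (∑ x' : TorusSite 2 M, ∑ y' : TorusSite 2 M,
              if (∀ i : Fin 2, (x' i).val / 2 = (X i).val) ∧ (∀ i : Fin 2, (y' i).val / 2 = 0) then
                (star ψ ⬝ᵥ Matrix.mulVec
                  (onSite x' (spinRaise 1) * onSite y' (spinLower 1)) ψ).re
              else 0) * (torusChar q X).re) /
          ((((M / 2 : ℕ)) : ℝ) ^ 2 * (∑ x' : TorusSite 2 M, ∑ y' : TorusSite 2 M,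
              if (∀ i : Fin 2, (x' i).val / 2 = ((0 : TorusSite 2 (M / 2)) i).val) ∧
                (∀ i : Fin 2, (y' i).val / 2 = 0) then
                (star ψ ⬝ᵥ Matrix.mulVec
                  (onSite x' (spinRaise 1) * onSite y' (spinLower 1)) ψ).re
              else 0)) *
          Real.exp ((∑ x : TorusSite 2 M, -Real.log ((∑ x' : TorusSite 2 M, ∑ y' : TorusSite 2 M,
            if (∀ i : Fin 2, (x' i).val / 2 = (x i).val / 2) ∧
              (∀ i : Fin 2, (y' i).val / 2 = ((0 : TorusSite 2 M) i).val / 2)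
            then (star ψ ⬝ᵥ Matrix.mulVec (onSite x' (spinRaise 1) * onSite y' (spinLower 1)) ψ).re
            else 0) /
          (∑ x' : TorusSite 2 M, ∑ y' : TorusSite 2 M,
            if (∀ i : Fin 2, (x' i).val / 2 = ((0 : TorusSite 2 M) i).val / 2) ∧
              (∀ i : Fin 2, (y' i).val / 2 = ((0 : TorusSite 2 M) i).val / 2)
            then (star ψ ⬝ᵥ Matrix.mulVec (onSite x' (spinRaise 1) * onSite y' (spinLower 1)) ψ).re
            else 0))) / (M : ℝ) ^ 2) := by
  intro M _ _ hEven h4 Δ ψ hψ hnorm heig hA S D c hS hc hcS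
  classical
  have hM : M = 2 * (M / 2) := (Nat.two_mul_div_two_of_even hEven).symm
  -- the coarse kernel
  set k₂ : TorusSite 2 (M / 2) → ℝ := fun X => ∑ x' : TorusSite 2 M, ∑ y' : TorusSite 2 M,
      if (∀ i : Fin 2, (x' i).val / 2 = (X i).val) ∧ (∀ i : Fin 2, (y' i).val / 2 = 0) then
        (star ψ ⬝ᵥ Matrix.mulVec (onSite x' (spinRaise 1) * onSite y' (spinLower 1)) ψ).re
      else 0 with hk₂
  have hpos : ∀ X, 0 < k₂ X := fun X => coarseKernel_pos M hM hEven h4 Δ ψ hψ hnorm heig X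
  have heven : ∀ X, k₂ (-X) = k₂ X := fun X => by
    simp only [hk₂]
    exact coarseKernel_neg M hM hEven Δ ψ hψ hnorm heig X
  have hk0 : k₂ 0 = ∑ x' : TorusSite 2 M, ∑ y' : TorusSite 2 M,
      if (∀ i : Fin 2, (x' i).val / 2 = ((0 : TorusSite 2 (M / 2)) i).val) ∧
          (∀ i : Fin 2, (y' i).val / 2 = 0)
      then (star ψ ⬝ᵥ Matrix.mulVec (onSite x' (spinRaise 1) * onSite y' (spinLower 1)) ψ).re
      else 0 := rfl
  -- the fine Lévy mass is the coarse mean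
  rw [levyMass_fine_eq_coarse M hM hEven h4 Δ ψ hψ hnorm heig, ← hk0]
  -- the Lévy bootstrap lemma on the coarse torus `(ℤ/(M/2))²`
  have h := levyMass_le_logBootstrap (d := 2) (L := M / 2) k₂ hpos heven hA S D hS hc hcS
  simpa only [hk₂] using h

/-- **The Lévy bootstrap lemma fed by `Block2InfDivXXZ`** (the antecedent of `stub_logBootstrap`):
on `Δ ∈ [-1, 0]`, block infinite divisibility gives the nonnegative Lévy coefficients
(`levyCoeff_nonneg_of_Block2InfDivXXZ`), so every normalised half-filled sector ground state of
`H_M(Δ)`, `M ≥ 4` even, satisfies `levyMass ≤ U + β·exp(levyMass)` for every admissible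
`(S, D, c)` as in `stub_levyBootstrapShape`. [folklore] -/
theorem levyBootstrapShape_of_Block2InfDivXXZ
    (hK1 : Summit.HubbardSuperconductivity.HubbardSuperconductivity.Theses.LevyLogBootstrap.Block2InfDivXXZ) :
    ∀ (M : ℕ) [NeZero M] [NeZero (M / 2)], Even M → 4 ≤ M → ∀ Δ ∈ Set.Icc (-1:ℝ) 0,
      ∀ (ψ : TensorIndex (TorusSite 2 M) 2 → ℂ),
      ψ ∈ @spinZSector (TorusSite 2 M) _ _ 1 0 → star ψ ⬝ᵥ ψ = 1 →
      Matrix.mulVec (xxzHamiltonian 1 (torusGraph 2 M) (-1) Δ) ψ =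
        ((lowestEnergyInSector 1 (xxzHamiltonian 1 (torusGraph 2 M) (-1) Δ) 0 : ℝ) : ℂ) • ψ →
      ∀ (S D : Finset (TorusSite 2 (M / 2))) (c : ℝ), (∀ q ∈ S, q ≠ 0) → 0 < c →
        (∀ q ∈ S, c ≤ ∑ Z ∈ D, (1 - (torusChar q Z).re)) →
        (∑ x : TorusSite 2 M, -Real.log ((∑ x' : TorusSite 2 M, ∑ y' : TorusSite 2 M,
            if (∀ i : Fin 2, (x' i).val / 2 = (x i).val / 2) ∧
              (∀ i : Fin 2, (y' i).val / 2 = ((0 : TorusSite 2 M) i).val / 2)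
            then (star ψ ⬝ᵥ Matrix.mulVec (onSite x' (spinRaise 1) * onSite y' (spinLower 1)) ψ).re
            else 0) /
          (∑ x' : TorusSite 2 M, ∑ y' : TorusSite 2 M,
            if (∀ i : Fin 2, (x' i).val / 2 = ((0 : TorusSite 2 M) i).val / 2) ∧
              (∀ i : Fin 2, (y' i).val / 2 = ((0 : TorusSite 2 M) i).val / 2)
            then (star ψ ⬝ᵥ Matrix.mulVec (onSite x' (spinRaise 1) * onSite y' (spinLower 1)) ψ).re
            else 0))) / (M : ℝ) ^ 2 ≤
        (∑ Z ∈ D, (Real.log (∑ x' : TorusSite 2 M, ∑ y' : TorusSite 2 M,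
              if (∀ i : Fin 2, (x' i).val / 2 = ((0 : TorusSite 2 (M / 2)) i).val) ∧
                (∀ i : Fin 2, (y' i).val / 2 = 0) then
                (star ψ ⬝ᵥ Matrix.mulVec
                  (onSite x' (spinRaise 1) * onSite y' (spinLower 1)) ψ).re
              else 0) -
            Real.log (∑ x' : TorusSite 2 M, ∑ y' : TorusSite 2 M,
              if (∀ i : Fin 2, (x' i).val / 2 = (Z i).val) ∧ (∀ i : Fin 2, (y' i).val / 2 = 0) then
                (star ψ ⬝ᵥ Matrix.mulVec
                  (onSite x' (spinRaise 1) * onSite y' (spinLower 1)) ψ).re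
              else 0))) / c +
        (∑ q ∈ (Finset.univ.erase 0) \ S, ∑ X : TorusSite 2 (M / 2),
            (∑ x' : TorusSite 2 M, ∑ y' : TorusSite 2 M,
              if (∀ i : Fin 2, (x' i).val / 2 = (X i).val) ∧ (∀ i : Fin 2, (y' i).val / 2 = 0) then
                (star ψ ⬝ᵥ Matrix.mulVec
                  (onSite x' (spinRaise 1) * onSite y' (spinLower 1)) ψ).re
              else 0) * (torusChar q X).re) /
          ((((M / 2 : ℕ)) : ℝ) ^ 2 * (∑ x' : TorusSite 2 M, ∑ y' : TorusSite 2 M,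
              if (∀ i : Fin 2, (x' i).val / 2 = ((0 : TorusSite 2 (M / 2)) i).val) ∧
                (∀ i : Fin 2, (y' i).val / 2 = 0) then
                (star ψ ⬝ᵥ Matrix.mulVec
                  (onSite x' (spinRaise 1) * onSite y' (spinLower 1)) ψ).re
              else 0)) *
          Real.exp ((∑ x : TorusSite 2 M, -Real.log ((∑ x' : TorusSite 2 M, ∑ y' : TorusSite 2 M,
            if (∀ i : Fin 2, (x' i).val / 2 = (x i).val / 2) ∧
              (∀ i : Fin 2, (y' i).val / 2 = ((0 : TorusSite 2 M) i).val / 2)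
            then (star ψ ⬝ᵥ Matrix.mulVec (onSite x' (spinRaise 1) * onSite y' (spinLower 1)) ψ).re
            else 0) /
          (∑ x' : TorusSite 2 M, ∑ y' : TorusSite 2 M,
            if (∀ i : Fin 2, (x' i).val / 2 = ((0 : TorusSite 2 M) i).val / 2) ∧
              (∀ i : Fin 2, (y' i).val / 2 = ((0 : TorusSite 2 M) i).val / 2)
            then (star ψ ⬝ᵥ Matrix.mulVec (onSite x' (spinRaise 1) * onSite y' (spinLower 1)) ψ).re
            else 0))) / (M : ℝ) ^ 2) := by
  intro M _ _ hEven h4 Δ hΔ ψ hψ hnorm heig S D c hS hc hcS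
  exact stub_levyBootstrapShape M hEven h4 Δ ψ hψ hnorm heig
    (levyCoeff_nonneg_of_Block2InfDivXXZ hK1 M hEven h4 Δ hΔ ψ hψ hnorm heig) S D c hS hc hcS

end Summit.HubbardSuperconductivity.HubbardSuperconductivity.Theorems.LevyLogBootstrap

end
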